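import Literature.NumberTheory.EllipticCurves.Tian2014.CMPointSystemFourTorsion
import Literature.NumberTheory.EllipticCurves.Tian2014.CMPointSystemMonskyDescent
import Literature.NumberTheory.EllipticCurves.Tian2014.ClassSixFamilyDescentProofs
import Literature.NumberTheory.QuadraticFields.RedeiReichardtFourRank
import Literature.NumberTheory.QuadraticFields.RedeiReichardtParametrisation
import Literature.GroupTheory.FiniteAbelian.StableTransversals
import HarnessLib

/-!
# Tian 2014 Prop. 4.6 (= Monsky 1990 Thm. 4.5, the `2p₃` case) transplanted onto the CM-point system:
# for `n = p ≡ 3 (mod 8)` prime, `2y_{2p} ∈ E(ℚ(√−2p))⁻ ∖ (2E(ℚ(√−2p))⁻ + E[2])` — the ONE-PRIME BASE CASE of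
# Monsky's odd-index descent, from the printed system plus the sentence «`σ_{1+ϖ}` moves `i` but fixes `√2`»

Cell `bsd-monsky` (prover-A seat, g13; `run/shared/lean/pub/bsd-monsky/`). HONEST FRAMING (README §1): nothing is
asserted about BSD, nothing is booked, no `_holds`; this file PROVES theorems on the data `D : CMPointData n` of
`CMPointSystemDisplays.lean` (Tian's system `(H(i), 𝒜, σ_t, σ_{1+ϖ}, conj, z_t)` with its printed properties as
hypotheses) and pure algebra on `E : y² = x³ − x`. NOTHING NEW ON PAPER: Tian proves Prop. 4.6 in print ("proved in
[19] (Monsky), we repeat its proof here for completeness"); the cell's enclosure had transplanted Monsky's Thm. 5.5 /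
5.9 (two odd primes) onto Tian's points — this is the `k = 0` base case of the SAME induction (Tian Thm. 4.5:
"k = 0 is given by Proposition 4.6"), for the even twist `m = 2p₀`, `p₀ ≡ 3 (mod 8)`.

## Source (verbatim, arXiv:1210.8231)

* Prop. 4.6 (p0023 L15–L22): "Let `n = p₀` be a prime congruent to `3` modulo `4`. Let `m = p₀` or `2p₀` such that
  `m ≡ 6, 7 mod 8`. Then we have `2y_m ∈ E(ℚ(√−m))⁻ ∖ (2E(ℚ(√−m))⁻ + E[2])`. In particular, `2y_m ∈ E(ℚ(√−m))⁻`
  is of infinite order and therefore `m` is a congruent number."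
* Proof, the `p₀ ≡ 3 mod 8` case (p0023 L57–p0024 L5): "Then `m = 2p₀ ≡ 6 mod 8` and `φ` has odd cardinality. …
  Suppose this is not the case, i.e. `2y_m = 2y + t` for some `y ∈ E(ℚ(√−m))⁻` and `t ∈ E[2]`. Then `P := y_m − y`
  is a `4`-torsion point. … `σ_{1+ϖ}(P) − P = σ_{1+ϖ}(y_m) − y_m = Σ_φ (0, 0) = (0, 0)`. On the other hand, …
  `E[4]/E[2]` is represented by `0, (i, 1 − i), (1 + √2, 2 + √2), (−1 − √2, i(2 + √2))`. Note that `σ_{1+ϖ}` moves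
  `i` but fixes `√2`. Thus `σ_{1+ϖ}` acts on any point `Q ∈ E[4]` via the complex conjugation. It follows immediately
  that `σ_{1+ϖ}(Q) − Q = 0` if `Q ≡ 0, (1 + √2, 2 + √2) mod E[2]` and `σ_{1+ϖ}(Q) − Q = (−1, 0)` otherwise. It is a
  contradiction."
* §4.2 (p0022 L67–L68): "if `p₀ ≡ 3 mod 8`, then `𝒜` has no order `4` elements, or equivalently, `2𝒜` has odd
  cardinality".

## What is proved here (kernel), and from what

* §1 (`CMPointSystemFourTorsion.lean`, imported) `map_sub_ne_ptZero_of_two_nsmul_two_nsmul_eq_zero`: for ANY field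
  `H` of characteristic `0`, ANY `σ ∈ Aut(H/ℚ)` with `σ(i) = −i` and `σ(√2) = √2` (every square root of `2` in `H`),
  and ANY `P ∈ E(H)` with `4P = 0`: `σ(P) − P ≠ (0, 0)` — Tian's finite check on `E[4]`, done on coordinates.
* §2–§4: transversals of `𝒜/[ϖ′]` exist; `#𝒜 = 2·#φ`; `#𝒜 = #(2𝒜)·#𝒜[2]`; and for `K = ℚ(√−2p)`, `p ≡ 3 (8)`:
  `#𝒜 = 2·(odd)` — from the tree's Gauss count `#𝒜[2] = 2^{t−1}` (`card_sq_eq_one_classGroup`) and the tree's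
  Rédei–Reichardt theorem (`redeiReichardt_fourTwoCard_classGroup_holds`, via `odd_genusClassNumber_two_mul_caseThree`
  at `k = 0`). So "`φ` has odd cardinality" is a KERNEL THEOREM, not a display.
* §5 `CMPointData.exists_transfer_eq_two_nsmul_yPoint_not_two_smul_add_torsion` (any `n`, any transversal of odd
  cardinality): `2y_{2n,φ}` is the transfer of a rational `y″ ∈ E_{2n}(ℚ)` (the tree's
  `exists_transfer_eq_two_nsmul_yPoint`) with `y″ ∉ 2E_{2n}(ℚ) + E_{2n}(ℚ)_tor`; and
  `…_prime_three_mod_eight` (`n = p ≡ 3 (8)` prime): the same for EVERY transversal, with "`φ` odd" proved.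
* NOT here: the `p₀ ≡ 7 (mod 8)` cases of Prop. 4.6 (`m = p₀`, `2p₀`; `𝒜[2^∞]` cyclic of order `≥ 2`, a transversal
  built from a generator, and `σ_t` moving `√2` for `t ∉ 2𝒜`) — they need further displayed sentences (§4.2
  Notations (ii) for prime `n`) and are left as printed.
* INPUTS: `D.Printed` (Thm. 2.8 (1)–(3), (4.8), the Galois facts — the displays of `CMPointSystemDisplays`) and ONE
  further printed sentence, taken as a BINDER (no new named fact): `hτ2 : ∀ s : H, s² = 2 → σ_{1+ϖ}(s) = s`
  ("`σ_{1+ϖ}` moves `i` but fixes `√2`", p0024 L1; `√2 ∈ H₀ ⊂ H`, p0022 L52, and `σ_{1+ϖ}` is the involution of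
  `H(i)/H`). Nothing else.

[cite: Tian2014, Prop. 4.6 and its proof (arXiv:1210.8231 p0023 L15–p0024 L5), §4.2 (p0022 L47–L68), Thm. 4.5 (p0023 L8–L14)]
[cite: Monsky1990MockHeegner, Thm. 4.5 (p. 57), Cor. 5.15 (1) (p. 66)] [cite: Cox2013, Prop. 3.11] [cite: LiMa2008, Thm. 0.4]
[cite: SilvermanAEC2009, III.2.3]
-/

noncomputable section

open scoped Classical

open Matrix WeierstrassCurve NumberField Literature.NumberTheory.EllipticCurves
  Literature.NumberTheory.EllipticCurves.TianYuanZhang2017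
  Literature.NumberTheory.EllipticCurves.HeathBrown1994
  Literature.NumberTheory.QuadraticFields.RedeiReichardt

set_option autoImplicit false

namespace Literature.NumberTheory.EllipticCurves.Tian2014

/-! ## §2 Transversals of `G/⟨π⟩` for an involution `π`: existence and `#G = 2·#φ` -/

section Transversals

variable {G : Type*} [CommGroup G]

/-- **A transversal of `G/⟨π⟩` exists** for an element `π ≠ 1` with `π² = 1` (a set of coset representatives of
the order-`2` subgroup `⟨π⟩`: "`φ ⊂ 𝒜` complete representatives of `𝒜/[ϖ′]`"). [cite: Tian2014, §4.2 (p0022 L84–L86)] [folklore] -/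
theorem exists_isReps_of_mul_self_eq_one [Finite G] (π : G) (hπ2 : π * π = 1) (hπ1 : π ≠ 1) :
    ∃ φ : Finset G, ∀ t, Xor (t ∈ φ) (π * t ∈ φ) := by
  classical
  set Q : Subgroup G := Subgroup.zpowers π with hQ
  have hπQ : π ∈ Q := Subgroup.mem_zpowers π
  obtain ⟨S, hS, -⟩ := Subgroup.exists_isComplement_left Q 1
  have hS' := Subgroup.isComplement_iff_existsUnique_inv_mul_mem.mp hS
  have hfin : S.Finite := Set.toFinite S
  set T : Finset G := hfin.toFinset with hT
  have hTmem : ∀ t, t ∈ T ↔ t ∈ S := fun t => Set.Finite.mem_toFinset hfin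
  have hπinv : π⁻¹ = π := inv_eq_of_mul_eq_one_right hπ2
  refine ⟨T, fun t => ?_⟩
  obtain ⟨⟨r, hrS⟩, hrq, hru⟩ := hS' t
  simp only at hrq hru
  have huniq : ∀ u, u ∈ S → u⁻¹ * t ∈ Q → u = r := fun u hu hut =>
    congrArg Subtype.val (hru ⟨u, hu⟩ hut)
  set q := r⁻¹ * t with hq
  have htq : t = r * q := by rw [hq, mul_inv_cancel_left]
  have hq2 : q = 1 ∨ q = π := by
    obtain ⟨m, hm⟩ := Subgroup.mem_zpowers_iff.mp hrq
    rw [← hm]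
    exact Literature.GroupTheory.FiniteAbelian.zpow_eq_one_or_self_of_mul_self_eq_one hπ2 m
  have hT1 : t ∈ T ↔ q = 1 := by
    rw [hTmem]
    constructor
    · intro ht
      have := huniq t ht (by rw [inv_mul_cancel]; exact Q.one_mem)
      rw [hq, ← this, inv_mul_cancel]
    · intro h1
      rw [htq, h1, mul_one]; exact hrS
  have hT2 : π * t ∈ T ↔ q = π := by
    rw [hTmem]
    constructor
    · intro ht
      have := huniq (π * t) ht (by rw [mul_inv, inv_mul_cancel_right, hπinv]; exact hπQ)
      rw [hq, ← this, mul_inv, inv_mul_cancel_right, hπinv]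
    · intro h
      have : π * t = r := by rw [htq, h, mul_comm r π, ← mul_assoc, hπ2, one_mul]
      rw [this]; exact hrS
  rw [hT1, hT2]
  rcases hq2 with h | h
  · exact Or.inl ⟨h, fun h' => hπ1 (h'.symm.trans h)⟩
  · exact Or.inr ⟨h, fun h' => hπ1 (h.symm.trans h')⟩

/-- **`#G = 2·#φ` for a transversal `φ` of `G/⟨π⟩`** (`π² = 1`): `G = φ ⊔ πφ`. [cite: Tian2014, §4.2 (p0022 L84–L86)] [folklore] -/
theorem natCard_eq_two_mul_card_of_isReps [Fintype G] {π : G} (hπ2 : π * π = 1) {φ : Finset G}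
    (hφ : ∀ t, Xor (t ∈ φ) (π * t ∈ φ)) : Nat.card G = 2 * φ.card := by
  classical
  have hdisj : Disjoint φ (φ.image fun t => π * t) := by
    rw [Finset.disjoint_left]
    intro x hx hx'
    obtain ⟨t, ht, rfl⟩ := Finset.mem_image.mp hx'
    rcases hφ t with ⟨-, h⟩ | ⟨-, h⟩
    · exact h hx
    · exact h ht
  have hunion : (Finset.univ : Finset G) = φ ∪ φ.image (fun t => π * t) := by
    ext x
    simp only [Finset.mem_univ, true_iff, Finset.mem_union, Finset.mem_image]
    rcases hφ x with ⟨h, -⟩ | ⟨h, -⟩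
    · exact Or.inl h
    · exact Or.inr ⟨π * x, h, by rw [← mul_assoc, hπ2, one_mul]⟩
  have hinj : Set.InjOn (fun t => π * t) (φ : Set G) := fun a _ b _ hab => mul_left_cancel hab
  rw [Nat.card_eq_fintype_card, ← Finset.card_univ, hunion, Finset.card_union_of_disjoint hdisj,
    Finset.card_image_of_injOn hinj, two_mul]

end Transversals

/-! ## §3 `#G = #(G²) · #G[2]` for a finite abelian group (the squaring map) -/

/-- **`#G = #G² · #G[2]`** for a finite abelian group `G` (first isomorphism theorem for `g ↦ g²`; Tian: "the
multiplication by `2` induces an isomorphism `𝒜[4]/𝒜[2] ≃ 𝒜[2] ∩ 2𝒜`" — the same map on `𝒜/𝒜[2] ≃ 2𝒜`).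
[cite: Tian2014, proof of Lemma 5.1 (arXiv p. 28, L13–L16)] [cite: Cox2013, §3.B (the genus map Cl → Cl/Cl², Prop. 3.11)] -/
theorem natCard_eq_card_isSquare_mul_card_sq_eq_one (G : Type*) [CommGroup G] [Finite G] :
    Nat.card G = Nat.card {a : G // IsSquare a} * Nat.card {c : G // c ^ 2 = 1} := by
  classical
  let f : G →* G := powMonoidHom 2
  have h1 : Nat.card G = Nat.card (G ⧸ f.ker) * Nat.card f.ker :=
    Subgroup.card_eq_card_quotient_mul_card_subgroup f.ker
  have h2 : Nat.card (G ⧸ f.ker) = Nat.card f.range :=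
    Nat.card_congr (QuotientGroup.quotientKerEquivRange f).toEquiv
  have h3 : Nat.card f.range = Nat.card {a : G // IsSquare a} := by
    refine Nat.card_congr (Equiv.subtypeEquivRight fun a => ?_)
    rw [MonoidHom.mem_range]
    constructor
    · rintro ⟨y, hy⟩
      exact ⟨y, by rw [← hy, powMonoidHom_apply, sq]⟩
    · rintro ⟨r, hr⟩
      exact ⟨r, by rw [powMonoidHom_apply, sq, hr]⟩
  have h4 : Nat.card f.ker = Nat.card {c : G // c ^ 2 = 1} :=
    Nat.card_congr (Equiv.subtypeEquivRight fun c => by rw [MonoidHom.mem_ker, powMonoidHom_apply])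
  rw [h1, h2, h3, h4]

/-! ## §4 `K = ℚ(√−2p)`, `p ≡ 3 (mod 8)`: `#𝒜 = 2·(odd)` from Gauss and Rédei–Reichardt (both tree theorems) -/

/-- **`#Cl(ℚ(√−2p)) ≡ 2 (mod 4)` for a prime `p ≡ 3 (mod 8)`**: `#𝒜[2] = 2^{t−1} = 2` (Gauss, `t = 2`) and
`#(2𝒜) = g(2p)` is odd (Rédei–Reichardt: the Rédei matrix of `−8p` has rank `1`, i.e. "`𝒜` has no order `4` elements,
or equivalently, `2𝒜` has odd cardinality", Tian p0022 L67–L68), so `#𝒜 = #(2𝒜)·#𝒜[2] = 2·(odd)`.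
[cite: Tian2014, §4.2 (p0022 L67–L68); Lemma 5.1 (p. 28)] [cite: Cox2013, Prop. 3.11] [cite: LiMa2008, Thm. 0.4] -/
theorem natCard_classGroup_genusField_two_mul_eq_two_mul_odd {p : ℕ} (hp : p.Prime) (hp8 : p % 8 = 3) :
    ∃ k : ℕ, Odd k ∧ Nat.card (ClassGroup (𝓞 (GenusField (2 * p)))) = 2 * k := by
  classical
  have hp2 : p ≠ 2 := by rintro rfl; norm_num at hp8
  have hd1 : 1 ≤ 2 * p := by have := hp.two_le; omega
  -- Gauss: `#𝒜[2] = 2`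
  have h2card : Nat.card {c : ClassGroup (𝓞 (GenusField (2 * p))) // c ^ 2 = 1} = 2 := by
    obtain ⟨x, -, hx⟩ := exists_ringOfIntegers_sq_eq_neg (K := GenusField (2 * p)) (root_genusField_sq hd1)
    have hq : ∀ i, ((![2, p] : Fin 2 → ℕ) i).Prime := by
      intro i; fin_cases i
      · exact Nat.prime_two
      · exact hp
    have hinj : Function.Injective (![2, p] : Fin 2 → ℕ) := by
      intro i j hij
      fin_cases i <;> fin_cases j <;> simp_all
    have hprod : ∏ i, (![2, p] : Fin 2 → ℕ) i = if (2 * p) % 4 = 1 then 2 * (2 * p) else 2 * p := by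
      rw [if_neg (by omega), Fin.prod_univ_two]; rfl
    have := natCard_sq_eq_one_eq (finrank_genusField (2 * p)) hx hq hinj hprod
    simpa using this
  -- Rédei–Reichardt (a tree theorem): `#(2𝒜) = g(2p)` is odd
  have hodd : Odd (genusClassNumber (GenusField (2 * p))) := by
    have hq : ∀ i, ((![p] : Fin 1 → ℕ) i).Prime := by intro i; fin_cases i; exact hp
    have hinj : Function.Injective (![p] : Fin 1 → ℕ) := fun i j _ => Subsingleton.elim i j
    have h30 : (![p] : Fin 1 → ℕ) 0 % 8 = 3 := hp8
    have h1 : ∀ i : Fin 1, i ≠ 0 → (![p] : Fin 1 → ℕ) i % 8 = 1 := fun i hi =>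
      absurd (Subsingleton.elim i 0) hi
    have hG : ∀ v : Fin 1 → ZMod 2, legendreMatrix ![p] *ᵥ v = 0 → v = 0 ∨ v = fun _ => 1 := by
      intro v _
      have hv : v = fun _ => v 0 := by funext i; rw [Subsingleton.elim i 0]
      rcases (by decide : ∀ a : ZMod 2, a = 0 ∨ a = 1) (v 0) with h | h
      · left; rw [hv, h]; rfl
      · right; rw [hv, h]
    have hn : ∏ i, (![p] : Fin 1 → ℕ) i = p := by simp
    exact odd_genusClassNumber_two_mul_caseThree ![p] redeiReichardt_fourTwoCard_classGroup_holds hq hinj h30 h1 hG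
      hn (GenusField (2 * p)) (isQuadraticFieldOfSqrt_genusField hd1)
  refine ⟨genusClassNumber (GenusField (2 * p)), hodd, ?_⟩
  rw [natCard_eq_card_isSquare_mul_card_sq_eq_one (ClassGroup (𝓞 (GenusField (2 * p)))), h2card, mul_comm]
  rfl

/-! ## §5 Tian Prop. 4.6 / Monsky Thm. 4.5 on the data: `2y_{2n,φ} ∉ 2E(K)⁻ + E[2]` for `|φ|` odd -/

namespace CMPointData

variable {n : ℕ}

/-- **Tian Prop. 4.6 (= Monsky Thm. 4.5), the descent step, on the data**: for a system `D` with the printed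
properties, `σ_{1+ϖ}` fixing the square roots of `2` (p0024 L1), and a transversal `φ` of `𝒜/[ϖ′]` of ODD
cardinality, the rational point `y″ ∈ E_{2n}(ℚ)` with `transfer y″ = 2y_{2n,φ}` (Prop. 4.6, (4.7)–(4.9): the tree's
`exists_transfer_eq_two_nsmul_yPoint`) is NOT of the form `2z + t` with `t` torsion: if it were, `P := y_{2n,φ} −
transfer z` would satisfy `2P = transfer t ∈ E[2]` and `σ_{1+ϖ}(P) − P = Σ_φ (0,0) = (0,0)` (`|φ|` odd, Thm. 2.8 (1);
`σ_{1+ϖ}` fixes the transfer image), which `E[4]` forbids (§1). `2n` square-free so that the torsion of `E_{2n}(ℚ)`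
is `2`-torsion. [cite: Tian2014, Prop. 4.6 proof (p0023 L57–p0024 L5)] [cite: Monsky1990MockHeegner, Thm. 4.5 (p. 57)] -/
theorem exists_transfer_eq_two_nsmul_yPoint_not_two_smul_add_torsion (D : CMPointData n) (hn : n ≠ 0)
    (hsq2n : Squarefree (2 * n)) (hP : D.Printed) (hτ2 : ∀ s : D.H, s ^ 2 = 2 → D.tau s = s)
    {φ : Finset (ClassGroup (𝓞 (GenusField (2 * n))))} (hφ : D.IsRepsModPiPrime φ) (hodd : Odd φ.card) :
    ∃ y' : (congruentNumberCurve (2 * n)).toAffine.Point, D.transfer hn y' = (2 : ℕ) • D.yPoint φ ∧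
      ∀ z t : (congruentNumberCurve (2 * n)).toAffine.Point, IsOfFinAddOrder t → y' ≠ (2 : ℤ) • z + t := by
  obtain ⟨y', hy'⟩ := D.exists_transfer_eq_two_nsmul_yPoint hn hP hφ
  refine ⟨y', hy', ?_⟩
  intro z t ht heq
  obtain ⟨h1, -, -, -, -, ⟨htaui, htauθ, -⟩, -, -, -, -, -⟩ := hP
  have ht2 : (2 : ℕ) • t = 0 := two_nsmul_eq_zero_of_isOfFinAddOrder_congruentNumberCurve hsq2n ht
  set S : EPoint D.H := D.transfer hn z with hS
  set T : EPoint D.H := D.transfer hn t with hT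
  have hyST : (2 : ℕ) • D.yPoint φ = (2 : ℕ) • S + T := by
    rw [← hy', heq, map_add, map_zsmul, two_zsmul, two_nsmul]
  have hT2 : (2 : ℕ) • T = 0 := by rw [hT, ← map_nsmul, ht2, map_zero]
  set P : EPoint D.H := D.yPoint φ - S with hPdef
  have h2P : (2 : ℕ) • P = T := by rw [hPdef, smul_sub, hyST]; abel
  have h4P : (2 : ℕ) • ((2 : ℕ) • P) = 0 := by rw [h2P, hT2]
  -- `σ_{1+ϖ}(P) − P = Σ_φ (0,0) = (0,0)` (`|φ|` odd; the transfer image is fixed by `σ_{1+ϖ}`)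
  have hSτ : D.act D.tau S = S := by
    rw [hS]; exact act_transferE_of_fix (2 * n) _ _ _ _ htauθ z
  have hyτ : D.act D.tau (D.yPoint φ) = D.yPoint φ + ptZero := by
    rw [yPoint, map_sum, Finset.sum_congr rfl (fun t _ => h1 t), Finset.sum_add_distrib, Finset.sum_const,
      odd_nsmul_of_two_nsmul_eq_zero two_nsmul_ptZero hodd]
  have hPτ : D.act D.tau P - P = ptZero := by
    rw [hPdef, map_sub, hSτ, hyτ]; abel
  exact map_sub_ne_ptZero_of_two_nsmul_two_nsmul_eq_zero D.tau D.im D.im_sq htaui hτ2 P h4P hPτ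

/-- **Every transversal of `𝒜/[ϖ′]` has odd cardinality for `n = p ≡ 3 (mod 8)` prime** ("`φ` has odd cardinality",
Prop. 4.6 proof p0023 L58): `#𝒜 = 2·#φ` and `#𝒜 = 2·(odd)` (§4). [cite: Tian2014, Prop. 4.6 proof (p0023 L57–L58), §4.2 (p0022 L67–L68)] -/
theorem odd_card_of_isRepsModPiPrime_prime_three_mod_eight (D : CMPointData n) (hn : n.Prime) (hn8 : n % 8 = 3)
    (hπ : D.piPrime * D.piPrime = 1) {φ : Finset (ClassGroup (𝓞 (GenusField (2 * n))))}
    (hφ : D.IsRepsModPiPrime φ) : Odd φ.card := by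
  obtain ⟨k, hk, hcard⟩ := natCard_classGroup_genusField_two_mul_eq_two_mul_odd hn hn8
  have h2 := natCard_eq_two_mul_card_of_isReps hπ hφ
  rw [hcard] at h2
  have : φ.card = k := by omega
  rw [this]; exact hk

/-- **Tian Prop. 4.6 for `m = 2p₀`, `p₀ ≡ 3 (mod 8)`, on the data — every transversal**: a transversal `φ` of
`𝒜/[ϖ′]` exists, and for every one the rational point `y″` with `transfer y″ = 2y_{2p₀,φ}` lies outside
`2E_{2p₀}(ℚ) + E_{2p₀}(ℚ)_tor` — in particular it is of infinite order, `rank E_{2p₀}(ℚ) ≥ 1` and `2p₀` is a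
congruent number (Monsky Thm. 4.5 / Cor. 5.15 (1) «`2p₃`», for Tian's point). Inputs: `D.Printed` and the binder
`hτ2` («`σ_{1+ϖ}` fixes `√2`», p0024 L1); "`φ` odd" and the `2`-torsion of `E_{2p₀}(ℚ)` are tree theorems.
[cite: Tian2014, Prop. 4.6 (p0023 L15–L22) and its proof (p0023 L57–p0024 L5)] [cite: Monsky1990MockHeegner, Thm. 4.5 (p. 57), Cor. 5.15 (1) (p. 66)] -/
theorem exists_transfer_eq_two_nsmul_yPoint_not_two_smul_add_torsion_prime_three_mod_eight (D : CMPointData n)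
    (hn : n.Prime) (hn8 : n % 8 = 3) (hP : D.Printed) (hτ2 : ∀ s : D.H, s ^ 2 = 2 → D.tau s = s) :
    (∃ φ, D.IsRepsModPiPrime φ) ∧
    ∀ φ : Finset (ClassGroup (𝓞 (GenusField (2 * n)))), D.IsRepsModPiPrime φ →
      ∃ y' : (congruentNumberCurve (2 * n)).toAffine.Point, D.transfer hn.ne_zero y' = (2 : ℕ) • D.yPoint φ ∧
        ∀ z t : (congruentNumberCurve (2 * n)).toAffine.Point, IsOfFinAddOrder t → y' ≠ (2 : ℤ) • z + t := by
  have hπ : D.piPrime * D.piPrime = 1 ∧ D.piPrime ≠ 1 := hP.2.2.2.2.2.2.2.2.2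
  have hsq : Squarefree (2 * n) :=
    Nat.squarefree_mul_iff.mpr ⟨(Nat.coprime_primes Nat.prime_two hn).mpr (by rintro rfl; norm_num at hn8),
      Nat.prime_two.prime.squarefree, hn.prime.squarefree⟩
  refine ⟨exists_isReps_of_mul_self_eq_one D.piPrime hπ.1 hπ.2, fun φ hφ => ?_⟩
  exact D.exists_transfer_eq_two_nsmul_yPoint_not_two_smul_add_torsion hn.ne_zero hsq hP hτ2 hφ
    (D.odd_card_of_isRepsModPiPrime_prime_three_mod_eight hn hn8 hπ.1 hφ)

end CMPointData

end Literature.NumberTheory.EllipticCurves.Tian2014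

end
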